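import Summits.Parity.GeneralizedHardyLittlewood.Theorems.DicksonFibrationDimOneDefs
import Summits.Parity.GeneralizedHardyLittlewood.Theorems.LeeYangFibresAbsoluteUpgradeSinglesDecayRemainder
import Literature.NumberTheory.Sieve.ParityBarrierLevelProofs
import Literature.NumberTheory.Sieve.PolymathGEHPieces
import Literature.NumberTheory.Sieve.BombieriAsymptoticSieveShiftedPrimes
import HarnessLib

/-!
# Route `DicksonFibration`, crux `DimOne` (stmt-Parity-0819), line `birth` (sieve-model reshape):
# helper file 1 for the stub `stub_primeClassSums` — one class of `Λ` in a value interval, and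
# Bombieri–Vinogradov at level `x^{1/4}`

Tools for the registered stub `stub_primeClassSums : PrimeClassSums` (file
`Theorems/DicksonFibrationDimOneStubPrimeClassSums.lean`):

* `abs_classSum_vonMangoldt_sub_le` — **one class in one value interval**: for `q ≥ 1`, `(r, q) = 1` and
  naturals `V₁ ≤ V₂ ≤ x`,
  `|∑_{V₁ < v ≤ V₂, v ≡ r (q)} Λ(v) − (V₂ − V₁)/φ(q)| ≤ 2 E*(x; q)`
  (`∑ = ψ(V₂; q, r) − ψ(V₁; q, r)`, tree `chebyshevPsiMod_natCast_sub`, and each end is within `E*(x; q)`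
  of its expected value, tree `abs_sub_le_primeAPError`; the end `V = 0` is exact);
* `primeAPError_le_of_natCast_le` — the **trivial bound** `E*(x; q) ≤ 3 x (1 + log x)²/q` for
  `1 ≤ q ≤ x` (`ψ(y; q, a) ≤ log y (y/q + 1)`, tree `BFI.chebyshevPsiMod_le_log_mul`, and
  `y/φ(q) ≤ x (1 + log q)²/q`, tree `totient_inv_le`);
* `abs_card_filter_Ioc_intModEq_sub_le` — a class `r (mod q)`, `r ∈ ℤ`, has `(V₂ − V₁)/q + O(1)` members
  in `(V₁, V₂]` (two-sided; tree `BFI.abs_card_Ioc_filter_modEq_sub_le`);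
* `bv_primeAPError_quarter` (registered sub-goal) — **Bombieri–Vinogradov at level `x^{1/4}`, unpacked**:
  for `A > 0` there are `C ≥ 0`, `x₀` with `∑_{q ≤ x^{1/4}} E*(x; q) ≤ C x/(log x)^A` for `x ≥ x₀`
  (the tree's PROVED `BombieriVinogradovStatement_holds` at `θ = 3/8`, `ε = 1/8`).

References: H. Iwaniec, E. Kowalski, *Analytic Number Theory* (2004), Thm. 17.1 and (17.2)
[IwaniecKowalski2004]; H. Halberstam, H.-E. Richert, *Sieve Methods* (1974), Ch. 1 Example 5
[HalberstamRichert1974].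
-/

noncomputable section

open scoped BigOperators
open Finset Filter Literature.NumberTheory.Sieve
open scoped ArithmeticFunction.vonMangoldt

namespace Summit.Parity.GeneralizedHardyLittlewood.Cruxes.DimOne.BirthSieve

/-! ### One class of `Λ` in one value interval -/

/-- `ψ(0; q, a) = 0` (the only term is `Λ(0) = 0`). [folklore] -/
theorem chebyshevPsiMod_natCast_zero (q : ℕ) (u : ZMod q) :
    LevelOfDistribution.chebyshevPsiMod q u ((0 : ℕ) : ℝ) = 0 := by
  unfold LevelOfDistribution.chebyshevPsiMod
  rw [Nat.cast_zero, Nat.floor_zero, zero_add, Finset.sum_range_one]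
  simp [ArithmeticFunction.vonMangoldt.residueClass, Set.indicator_apply]

/-- One end of a value interval: `|ψ(V; q, a) − V/φ(q)| ≤ E*(x; q)` for a natural `V ≤ x` and a reduced
class `a` (`V ≥ 1`: definition of `E*`, tree `abs_sub_le_primeAPError`; `V = 0`: both terms vanish).
[cite: IwaniecKowalski2004, (17.2)] -/
theorem abs_chebyshevPsiMod_natCast_sub_le {q : ℕ} (hq : q ≠ 0) (u : (ZMod q)ˣ) {V : ℕ} {x : ℝ}
    (hVx : (V : ℝ) ≤ x) :
    |LevelOfDistribution.chebyshevPsiMod q u V - (V : ℝ) / Nat.totient q| ≤ primeAPError x q := by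
  rcases Nat.eq_zero_or_pos V with rfl | hV
  · rw [chebyshevPsiMod_natCast_zero, Nat.cast_zero, zero_div, sub_zero, abs_zero]
    exact primeAPError_nonneg x q
  · exact abs_sub_le_primeAPError hq (by exact_mod_cast hV) hVx u

/-- **One class of `Λ` in one value interval.** For `q ≥ 1`, an integer `r` coprime to `q` and naturals
`V₁ ≤ V₂ ≤ x`: `|∑_{V₁ < v ≤ V₂, v ≡ r (mod q)} Λ(v) − (V₂ − V₁)/φ(q)| ≤ 2 E*(x; q)`
(`∑ = ψ(V₂; q, r) − ψ(V₁; q, r)` and each end is within `E*(x; q)` of its expected value).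
[cite: IwaniecKowalski2004, (17.2)] -/
theorem abs_classSum_vonMangoldt_sub_le {q : ℕ} (hq : 0 < q) {r : ℤ} (hr : IsCoprime r q)
    {V₁ V₂ : ℕ} (hV : V₁ ≤ V₂) {x : ℝ} (hV₂x : (V₂ : ℝ) ≤ x) :
    |∑ v ∈ (Ioc V₁ V₂).filter (fun v : ℕ => (v : ℤ) ≡ r [ZMOD q]), Λ v -
        ((V₂ : ℝ) - V₁) / Nat.totient q| ≤ 2 * primeAPError x q := by
  have hq0 : q ≠ 0 := hq.ne'
  set u : (ZMod q)ˣ := ZMod.unitOfIsCoprime r hr with hu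
  have hu' : ((u : ZMod q)) = (r : ZMod q) := ZMod.coe_unitOfIsCoprime r hr
  have hfilt : (Ioc V₁ V₂).filter (fun v : ℕ => (v : ℤ) ≡ r [ZMOD q]) =
      (Ioc V₁ V₂).filter (fun v : ℕ => (v : ZMod q) = (u : ZMod q)) := by
    refine Finset.filter_congr fun v _ => ?_
    rw [hu', ← ZMod.intCast_eq_intCast_iff, Int.cast_natCast]
  rw [hfilt, ← chebyshevPsiMod_natCast_sub (u : ZMod q) hV]
  have e2 := abs_chebyshevPsiMod_natCast_sub_le hq0 u hV₂x
  have e1 := abs_chebyshevPsiMod_natCast_sub_le hq0 u ((Nat.cast_le.mpr hV).trans hV₂x)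
  have hsplit : LevelOfDistribution.chebyshevPsiMod q u V₂ -
      LevelOfDistribution.chebyshevPsiMod q u V₁ - ((V₂ : ℝ) - V₁) / Nat.totient q =
      (LevelOfDistribution.chebyshevPsiMod q u V₂ - (V₂ : ℝ) / Nat.totient q) -
        (LevelOfDistribution.chebyshevPsiMod q u V₁ - (V₁ : ℝ) / Nat.totient q) := by
    ring
  rw [hsplit]
  calc _ ≤ |LevelOfDistribution.chebyshevPsiMod q u V₂ - (V₂ : ℝ) / Nat.totient q| +
        |LevelOfDistribution.chebyshevPsiMod q u V₁ - (V₁ : ℝ) / Nat.totient q| := abs_sub _ _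
    _ ≤ primeAPError x q + primeAPError x q := add_le_add e2 e1
    _ = 2 * primeAPError x q := by ring

/-! ### The trivial bound for `E*(x; q)` -/

/-- **Trivial bound** `E*(x; q) ≤ 3 x (1 + log x)²/q` for `1 ≤ q ≤ x`: for `1 ≤ y ≤ x` and a reduced
class `a`, `0 ≤ ψ(y; q, a) ≤ log y (y/q + 1) ≤ 2 x (1 + log x)²/q` and
`0 ≤ y/φ(q) ≤ x (1 + log q)²/q`. [folklore] -/
theorem primeAPError_le_of_natCast_le {x : ℝ} (hx : 1 ≤ x) {q : ℕ} (hq : 0 < q)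
    (hqx : (q : ℝ) ≤ x) : primeAPError x q ≤ 3 * x * (1 + Real.log x) ^ 2 / q := by
  have hx0 : 0 < x := by linarith
  have hq0 : (0 : ℝ) < q := by exact_mod_cast hq
  have hq1 : (1 : ℝ) ≤ q := by exact_mod_cast hq
  have hL0 : 0 ≤ Real.log x := Real.log_nonneg hx
  set M : ℝ := x * (1 + Real.log x) ^ 2 / q with hM
  have hM0 : 0 ≤ M := by positivity
  have hbound : 0 ≤ 3 * x * (1 + Real.log x) ^ 2 / q := by positivity
  have h3M : 3 * x * (1 + Real.log x) ^ 2 / q = 3 * M := by rw [hM]; ring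
  unfold primeAPError
  refine Real.iSup_le (fun y => Real.iSup_le (fun u => ?_) hbound) hbound
  obtain ⟨hy1, hyx⟩ := y.2
  have hy0 : (0 : ℝ) ≤ y := by linarith
  have hψ0 : 0 ≤ LevelOfDistribution.chebyshevPsiMod q u y :=
    Finset.sum_nonneg fun n _ => ArithmeticFunction.vonMangoldt.residueClass_nonneg _ _
  have hlogy : Real.log y ≤ Real.log x := Real.log_le_log (by linarith) hyx
  have hlogy0 : 0 ≤ Real.log y := Real.log_nonneg hy1
  -- `ψ(y; q, a) ≤ 2 M`
  have hψ : LevelOfDistribution.chebyshevPsiMod q u y ≤ 2 * M := by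
    have hxq : 1 ≤ x / q := by rw [le_div_iff₀ hq0, one_mul]; exact hqx
    calc LevelOfDistribution.chebyshevPsiMod q u y ≤ Real.log y * (y / q + 1) :=
          BFI.chebyshevPsiMod_le_log_mul hq _ hy1
      _ ≤ Real.log x * (x / q + x / q) :=
          mul_le_mul hlogy (add_le_add (div_le_div_of_nonneg_right hyx hq0.le) hxq)
            (by positivity) hL0
      _ ≤ (1 + Real.log x) ^ 2 * (x / q + x / q) := by
          refine mul_le_mul_of_nonneg_right ?_ (by positivity)
          nlinarith
      _ = 2 * M := by rw [hM]; ring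
  -- `y/φ(q) ≤ M`
  have hφ : (y : ℝ) / Nat.totient q ≤ M := by
    have h1 := totient_inv_le (d := q) hq.ne'
    have hlogq : Real.log q ≤ Real.log x := Real.log_le_log hq0 hqx
    have hlogq0 : 0 ≤ Real.log q := Real.log_nonneg hq1
    calc (y : ℝ) / Nat.totient q = y * ((Nat.totient q : ℝ))⁻¹ := div_eq_mul_inv _ _
      _ ≤ x * ((1 + Real.log q) ^ 2 / q) :=
          mul_le_mul hyx h1 (inv_nonneg.mpr (Nat.cast_nonneg _)) hx0.le
      _ ≤ x * ((1 + Real.log x) ^ 2 / q) := by gcongr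
      _ = M := by rw [hM]; ring
  have hφ0 : 0 ≤ (y : ℝ) / Nat.totient q := div_nonneg hy0 (Nat.cast_nonneg _)
  rw [h3M, abs_le]
  constructor <;> linarith

/-! ### Members of an integer class in a segment -/

/-- A class `r (mod q)` (`q ≥ 1`, `r ∈ ℤ`) has `(V₂ − V₁)/q + ϑ`, `|ϑ| ≤ 1`, members in `(V₁, V₂]`
(tree: `BFI.abs_card_Ioc_filter_modEq_sub_le` for the natural representative of `r`). [folklore] -/
theorem abs_card_filter_Ioc_intModEq_sub_le {q : ℕ} (hq : 0 < q) (r : ℤ) {V₁ V₂ : ℕ} (hV : V₁ ≤ V₂) :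
    |(#((Ioc V₁ V₂).filter (fun v : ℕ => (v : ℤ) ≡ r [ZMOD q])) : ℝ) - ((V₂ : ℝ) - V₁) / q| ≤ 1 := by
  -- adapted from `AbsoluteUpgrade.card_filter_Ioc_intModEq_le`
  set c := (r % q).toNat with hc
  have hq' : (0 : ℤ) < q := by exact_mod_cast hq
  have hc0 : 0 ≤ r % q := Int.emod_nonneg _ hq'.ne'
  have hceq : ((c : ℕ) : ℤ) = r % q := Int.toNat_of_nonneg hc0
  have hclt : c < q := by
    have h1 := Int.emod_lt_of_pos r hq'
    rw [← hceq] at h1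
    exact_mod_cast h1
  have hfilt : (Ioc V₁ V₂).filter (fun v : ℕ => (v : ℤ) ≡ r [ZMOD q]) =
      (Ioc V₁ V₂).filter (fun v : ℕ => v ≡ c [MOD q]) := by
    refine Finset.filter_congr fun v _ => ?_
    rw [Nat.ModEq, Nat.mod_eq_of_lt hclt]
    have e : ((v : ℤ) ≡ r [ZMOD (q : ℤ)]) ↔ ((v % q : ℕ) : ℤ) = ((c : ℕ) : ℤ) := by
      rw [hceq, Int.natCast_mod]
      rfl
    rw [e]
    exact Int.natCast_inj
  rw [hfilt]
  exact BFI.abs_card_Ioc_filter_modEq_sub_le hq c hV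

/-! ### Small tools for the assembly -/

/-- The class `a s + b` of a root class `s` is reduced modulo `|a| d` once `(a s + b, d) = 1` and
`(a, b) = 1`. [folklore] -/
theorem isCoprime_form_natAbs_mul {a b : ℤ} (hab : IsCoprime a b) {s : ℕ} {d : ℕ}
    (hsd : Int.gcd (a * s + b) d = 1) : IsCoprime (a * (s : ℤ) + b) ((a.natAbs * d : ℕ) : ℤ) := by
  rw [Nat.cast_mul, Int.natCast_natAbs]
  exact IsCoprime.mul_right (hab.symm.mul_add_left_left (s : ℤ)).abs_right
    (Int.isCoprime_iff_gcd_eq_one.mpr hsd)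

/-- Cauchy–Schwarz with nonnegative weights: `(∑ ρ M)² ≤ (∑ ρ² M)(∑ M)` for `M ≥ 0`. [folklore] -/
theorem sq_sum_mul_le {s : Finset ℕ} {ρ M : ℕ → ℝ} (hM : ∀ d ∈ s, 0 ≤ M d) :
    (∑ d ∈ s, ρ d * M d) ^ 2 ≤ (∑ d ∈ s, ρ d ^ 2 * M d) * ∑ d ∈ s, M d := by
  have hCS := Finset.sum_mul_sq_le_sq_mul_sq s (fun d => ρ d * Real.sqrt (M d))
    (fun d => Real.sqrt (M d))
  have e1 : ∀ d ∈ s, ρ d * Real.sqrt (M d) * Real.sqrt (M d) = ρ d * M d := fun d hd => by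
    rw [mul_assoc, Real.mul_self_sqrt (hM d hd)]
  have e2 : ∀ d ∈ s, (ρ d * Real.sqrt (M d)) ^ 2 = ρ d ^ 2 * M d := fun d hd => by
    rw [mul_pow, Real.sq_sqrt (hM d hd)]
  have e3 : ∀ d ∈ s, Real.sqrt (M d) ^ 2 = M d := fun d hd => Real.sq_sqrt (hM d hd)
  rwa [Finset.sum_congr rfl e1, Finset.sum_congr rfl e2, Finset.sum_congr rfl e3] at hCS

/-- **`∑_{d ≤ D} c^{ω(d)}/d ≤ e^{10c} (log x)^{2c}`** for `c ≥ 0` and `2 ≤ D ≤ x` (the tree's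
`AbsoluteUpgrade.sum_pow_omega_div_le` with `log log D ≤ log log x`). [cite: HalberstamRichert1974, §5.7] -/
theorem sum_pow_omega_div_le_exp {c : ℝ} (hc : 0 ≤ c) {D : ℕ} (hD : 2 ≤ D) {x : ℝ}
    (hDx : (D : ℝ) ≤ x) :
    ∑ d ∈ Icc 1 D, c ^ ArithmeticFunction.cardDistinctFactors d / d ≤
      Real.exp (10 * c) * Real.exp (2 * c * Real.log (Real.log x)) := by
  have h2 : (2 : ℝ) ≤ D := by exact_mod_cast hD
  have hlogD : 0 < Real.log D := Real.log_pos (by linarith)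
  have hloglog : Real.log (Real.log D) ≤ Real.log (Real.log x) :=
    Real.log_le_log hlogD (Real.log_le_log (by linarith) hDx)
  refine (Summit.Parity.GeneralizedHardyLittlewood.Theorems.AbsoluteUpgrade.sum_pow_omega_div_le
    hc hD).trans ?_
  rw [← Real.exp_add]
  refine Real.exp_le_exp.mpr ?_
  have := mul_le_mul_of_nonneg_left hloglog (by positivity : (0 : ℝ) ≤ 2 * c)
  nlinarith

/-- `c (log x)^n ≤ x` eventually (`(log x)^n = o(x)`, Mathlib's `isLittleO_log_rpow_rpow_atTop`).
[folklore] -/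
theorem eventually_const_mul_log_pow_le (c : ℝ) (n : ℕ) :
    ∀ᶠ x : ℝ in atTop, c * Real.log x ^ n ≤ x := by
  have h := ((isLittleO_log_rpow_rpow_atTop (n : ℝ) one_pos).const_mul_left c).eventuallyLE
  filter_upwards [h, eventually_ge_atTop (1 : ℝ)] with x hx hx1
  rw [Real.norm_eq_abs, Real.norm_eq_abs, Real.rpow_one, abs_of_nonneg (by linarith : (0 : ℝ) ≤ x),
    Real.rpow_natCast] at hx
  exact (le_abs_self _).trans hx

/-! ### Bombieri–Vinogradov at level `x^{1/4}` -/

/-- **Bombieri–Vinogradov at level `x^{1/4}`, unpacked.** For `A > 0` there are `C ≥ 0` and `x₀` such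
that `∑_{q ≤ x^{1/4}} E*(x; q) ≤ C x/(log x)^A` for all `x ≥ x₀` (the tree's PROVED
`BombieriVinogradovStatement_holds : ∀ θ < 1/2, PrimesHaveLevel θ` at `θ = 3/8`, `ε = 1/8`, with the
`IsBigO` unpacked along `atTop`). [cite: IwaniecKowalski2004, Theorem 17.1] -/
theorem bv_primeAPError_quarter : ∀ (A : ℝ), 0 < A → ∃ C x₀ : ℝ, 0 ≤ C ∧ ∀ x : ℝ, x₀ ≤ x → ∑ q ∈ Finset.Icc 1 ⌊x ^ (1 / 4 : ℝ)⌋₊, Literature.NumberTheory.Sieve.primeAPError x q ≤ C * x / Real.log x ^ A := by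
  intro A hA
  have hBV : PrimesHaveLevel (3 / 8) := BombieriVinogradovStatement_holds (3 / 8) (by norm_num)
  have h := hBV A hA (1 / 8) (by norm_num)
  rw [Asymptotics.isBigO_iff] at h
  obtain ⟨c, hc⟩ := h
  obtain ⟨x₁, hx₁⟩ := Filter.eventually_atTop.1 (hc.and (Filter.eventually_gt_atTop (1 : ℝ)))
  refine ⟨max c 0, x₁, le_max_right _ _, fun x hx => ?_⟩
  obtain ⟨hcx, hx1⟩ := hx₁ x hx
  have hx0 : 0 < x := by linarith
  have hL : 0 < Real.log x := Real.log_pos hx1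
  have hLA : 0 < Real.log x ^ A := Real.rpow_pos_of_pos hL A
  have hexp : (3 / 8 - 1 / 8 : ℝ) = 1 / 4 := by norm_num
  rw [hexp, Real.norm_eq_abs, Real.norm_eq_abs,
    abs_of_nonneg (Finset.sum_nonneg fun q _ => primeAPError_nonneg x q),
    abs_of_nonneg (div_nonneg hx0.le hLA.le)] at hcx
  calc _ ≤ c * (x / Real.log x ^ A) := hcx
    _ ≤ max c 0 * (x / Real.log x ^ A) :=
        mul_le_mul_of_nonneg_right (le_max_left _ _) (div_nonneg hx0.le hLA.le)
    _ = max c 0 * x / Real.log x ^ A := by ring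

end Summit.Parity.GeneralizedHardyLittlewood.Cruxes.DimOne.BirthSieve

end
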